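import Literature.NumberTheory.LFunctions.NonvanishingPrimePowerLevel
import Mathlib.MeasureTheory.Integral.IntervalIntegral.Basic
import Mathlib.NumberTheory.LSeries.RiemannZeta
import HarnessLib

/-!
# The exact harmonic second moment of `L_f(½ + it)` over `S_{2k}(Γ₀(N))`, every weight and level
# (Bykovskii–Frolenkov, Izv. Math. 81 (2017), §1: Theorems 1.1 and 1.2)

Topic `Literature/NumberTheory/LFunctions` (namespace `Literature.NumberTheory.LFunctions`; the
paper's objects in the sub-namespace `BykovskiiFrolenkov2017`). STATEMENT LAYER (D-0014): TWO NAMED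
FACTS (`def … : Prop`, theorems in print, not proved here) — Theorem 1.1 (the second moment at a
point `½ + it`) and Theorem 1.2 (its integral over `0 ≤ t ≤ T`) — over the tree's carriers
`peterssonProduct (Gamma0 N)` (the Petersson product, `HeckeOperators.lean`),
`IwaniecSarnak.analyticL` (the analytically normalised `L`-series of a cusp form, continued;
`NonvanishingPrimePowerLevel.lean`), `BalkanovaFrolenkov2017.digamma` (`Γ′/Γ`), Mathlib's
`riemannZeta`, `Complex.Gamma`, `Real.eulerMascheroniConstant`; plus PROVED bookkeeping: the
statement for an arbitrary finite index type, the identification of the printed normalising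
constant with the tree's harmonic weight `IwaniecSarnak.harmonicWeight` on an orthonormal basis,
and the reshaping of the left-hand side into the weighted-family currency
`Σ ω·M²·L²` (`M ≡ 1`) of `CentralValueFamilyPigeonhole.weight_floor_ge_of_mollified`.

Typed for the cell `landau-siegel` (rung F-S3, §C harvest row T-140 = P-201, reader r7; tag
E*-fam): the EXACT main term `W_{2k}(N;t)` of the unmollified harmonic second moment at EVERY
`(k, N)` — the `A₂ / W` mass input of the §B-fam evaluator at twist `l = 1` (consumer named by
ls-lit-lead 2026-08-26T18:21:24Z: the second-moment side of `weight_floor_ge_of_mollified`,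
p455844). It is a diagonal-range statement (no twist, no mollifier): it does not bear on the
½-proportion knife edge by itself.

## What the source prints (held text `paper:arxiv-1608.00555`, corpus-tex = the Russian original,
## chunk p0003, read 2026-08-26; English translation: Izv. Math. 81:2 (2017) 239–268)

В. А. Быковский, Д. А. Фроленков, *Асимптотические формулы для вторых моментов `L`-рядов
голоморфных параболических форм на критической прямой*, Изв. РАН Сер. матем. 81:2 (2017) 5–34
= arXiv:1608.00555 [BykovskiiFrolenkov2017].

§1 (p0003:L3–L20): "`S_{2k}(N)` — the complex linear space of holomorphic cusp forms of even integer
weight `2k ≥ 2` for the congruence subgroup `Γ₀(N)`. Every `f ∈ S_{2k}(N)` has a Fourier expansion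
`f(z) = Σ_{n≥1} ρ_f(n) e(nz)` … the associated `L`-series
`L_f(s) = Σ_{n≥1} ρ_f(n) n^{−(s+k−1/2)}`, `L*_f(s) = Σ conj(ρ_f(n)) n^{−(s+k−1/2)}`, absolutely
convergent in `Re s > 1`, define functions holomorphic in `s` on the whole plane. The space
`S_{2k}(N)` is finite-dimensional and we may choose in it an orthonormal basis `O_{2k}(N)` with
respect to the Petersson scalar product `⟨f,g⟩ = ∬_{Γ₀(N)\H} f(z) conj(g(z)) y^{2k−2} dx dy`."
(p0003:L27–L35):
`W_{2k}(N;t) = log N + 2γ − 2 log(2π) + Γ′/Γ(k+it) + Γ′/Γ(k−it)` (1.1),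
`U_{2k}(t) = ζ(1+2it)(2π)^{−2it} Γ(k+it)/Γ(k−it) + ζ(1−2it)(2π)^{2it} Γ(k−it)/Γ(k+it)`,
"`γ` Euler's constant, `Γ(s)` and `ζ(s)` the gamma function and the Riemann zeta function."

> **Теорема 1.1** (p0003:L38–L50). Пусть `k` и `N` — натуральные числа, `t` — вещественное. Тогда
> `(Γ(2k−1)/(4π)^{2k−1}) Σ_{f ∈ O_{2k}(N)} |L_f(½ + it)|² = W_{2k}(N;t) + (−1)^k δ_{1,N} U_{2k}(t) + V₁(k,N;t)`
> и для любого `ε > 0`: `V₁(k,N;t) ≪_ε ((1+|t|)/(kN)) · (kN(1+|t|))^ε`.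

> **Теорема 1.2** (p0003:L52–L63). Пусть `k` и `N` — натуральные числа, `T` — вещественное число,
> большее 1. Тогда
> `(Γ(2k−1)/(4π)^{2k−1}) Σ_{f ∈ O_{2k}(N)} ∫₀^T |L_f(½ + it)|² dt = ∫₀^T (W_{2k}(N;t) + (−1)^k δ_{1,N} U_{2k}(t)) dt + V₂(k,N;T)`
> и для любого `ε > 0`: `V₂(k,N;T) ≪_ε (T/(kN)) · (kNT)^ε`.

(p0003:L66): "`δ_{1,N}` is the Kronecker symbol, `1` for `N = 1` and `0` for `N > 1`."
(p0003:L82–L89): for prime `N` and `k ∈ {1,2,3,4,5,7}` there are no old forms, `S_{2k}(N) = S^{new}`,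
and the elements of `O_{2k}(N)` and of the newform basis `H*_{2k}(N)` "differ only by normalisation";
"in the special case `k = 1`, `t = 0`, `N` prime, Theorem 1.1 coincides with the result of H. Bui."

## Lean rendering / design choices (audit notes for ls-lit-ref)

* `S_{2k}(N)` = `CuspForm (Gamma0 N) (2k)` (weight `2k : ℤ`, `k : ℕ`, `1 ≤ k`); `ρ_f(n)` =
  `cuspCoeff f n`; `L_f(s) = Σ ρ_f(n) n^{−(s + (2k−1)/2)}` continued is VERBATIM the tree's
  `IwaniecSarnak.analyticL f s` (value at `s + (κ−1)/2` of the entire continuation of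
  `Σ a_f(n) n^{−s}`, here `κ = 2k`) — the same carrier typer-4 used for Balkanova–Frolenkov 2018.
* The Petersson product `∬ f conj(g) y^{2k−2} dx dy = ∫ f conj(g) y^{2k} dμ` is the tree's
  `peterssonProduct (Gamma0 N) (2k) g f` (Mathlib's integrand `conj(f) g (im τ)^k`, antilinear in the
  FIRST slot; same normalisation, no volume factor). "Orthonormal basis `O_{2k}(N)`" =
  `BykovskiiFrolenkov2017.IsOrthonormalBasis b` for a finite family `b : ι → S_{2k}(N)`: Gram matrix
  `⟨b_i, b_j⟩ = δ_{ij}` and `b` spans `S_{2k}(N)` over `ℂ`. The facts quantify over EVERY such basis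
  indexed by `Fin n` (print: "we may choose an orthonormal basis" — the identity holds for any
  choice); the version for an arbitrary finite index type is PROVED (`…theorem11.of_fintype`), and so is the
  version over any Petersson-ORTHOGONAL basis of nonzero forms with the tree's harmonic weights
  `ω_f = Γ(κ−1)/((4π)^{κ−1}⟨f,f⟩)` (`…theorem11.harmonic`, via `L_{cf} = cL_f` and
  `⟨cf,cf⟩ = |c|²⟨f,f⟩`, both proved here from tree theorems).
* The left side `(Γ(2k−1)/(4π)^{2k−1}) Σ_f |L_f(½+it)|²` is `secondMoment b t : ℝ`; the constant
  `Γ(κ−1)/(4π)^{κ−1}` (`gammaFactor κ`, real `rpow` as in `IwaniecSarnak.harmonicWeight`) is, on an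
  orthonormal basis (`⟨f,f⟩ = 1`), exactly the tree's harmonic weight `ω_f` — PROVED
  (`harmonicWeight_eq_gammaFactor`, `secondMoment_eq_harmonic`).
* `W_{2k}(N;t)`, `U_{2k}(t)` are `mainTermW k N t`, `mainTermU k t : ℂ` (both are real numbers in
  print; typed in `ℂ`, the identity being read as `|LHS − W − (−1)^k δ U| ≤ C·(error)`), with
  `Γ′/Γ = BalkanovaFrolenkov2017.digamma`, `ζ = riemannZeta`, `(2π)^{±2it}` = complex power of the
  positive real `2π`. `V ≪_ε X` = `∀ ε > 0 ∃ C > 0`, the bound `C·X` UNIFORM in `k ≥ 1`, `N ≥ 1`, `t`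
  (resp. `T > 1`) as printed ("Пусть `k` и `N` — натуральные числа, `t` — вещественное").
* THE POINT `(N, t) = (1, 0)`. For `N = 1` the printed `U_{2k}(t)` has a removable singularity at
  `t = 0` (the poles of `ζ(1 ± 2it)` cancel in the sum; the value meant is the limit
  `2γ − 2 log 2π + 2Γ′/Γ(k)`, consistent with `S_2(1) = 0`). Mathlib's `riemannZeta 1` is a junk
  value, so Theorem 1.1 is typed with the side condition `N = 1 → t ≠ 0` — WEAKER than print at that
  single point only, nowhere stronger. Theorem 1.2 integrates over `t` and needs no exclusion (the
  integrand is changed at one point at most).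
* Theorem 1.2's left side keeps the printed order `Σ_f ∫₀^T` (finite sum of interval integrals of
  the continuous functions `|L_f(½+it)|²`); the right side is the interval integral of the
  `ℂ`-valued main term.
* NOT typed: the convolution formula for weight 2 (§§2–4), the bound of Sankaranarayanan quoted on
  p0003:L70–L80, the twisted generalisation "the methods carry over to arbitrary `l`" (p0003:L88 —
  a sentence, not a theorem; the twisted prime-power-level case is Balkanova–Frolenkov 2018
  Theorem 1.5 = `balkanovaFrolenkov2017_theorem15`).

WHAT THIS IS NOT: no claim about Landau–Siegel zeros, about Theorems 1–2 of arXiv:2211.02515 or a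
repaired `Margin232`; a diagonal-range identity, no mollifier, no twist. «The programme SEARCHES
and TYPES; no claim about Landau–Siegel zeros, Theorems 1–2 of arXiv:2211.02515 or a repaired
Margin232 until a kernel theorem says so.»

## References

* [BykovskiiFrolenkov2017] §1: the setting (p0003:L3–L20), (1.1) `W_{2k}`, `U_{2k}` (p0003:L27–L35),
  Theorem 1.1 (p0003:L38–L50), Theorem 1.2 (p0003:L52–L63), `δ_{1,N}` (p0003:L66).
* [BalkanovaFrolenkov2017] (tree file `NonvanishingPrimePowerLevel.lean`: `analyticL`, `digamma`).
* [IwaniecKowalski2004] Prop. 14.5 (the harmonic weight; tree `IwaniecSarnak.harmonicWeight`).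
* Tree: `CentralValueFamilyPigeonhole.weight_floor_ge_of_mollified` (the consumer's currency).
-/

noncomputable section

open scoped MatrixGroups
open CongruenceSubgroup Complex Finset
open Literature.NumberTheory.EllipticCurves.ModularForms

namespace Literature.NumberTheory.LFunctions

open IwaniecSarnak BalkanovaFrolenkov2017

/-! ### The paper's objects -/

namespace BykovskiiFrolenkov2017

variable {N : ℕ} {κ : ℤ}

/-- **An orthonormal basis `O_κ(N)` of `S_κ(Γ₀(N))` for the Petersson product**: a finite family
`b : ι → S_κ(N)` with Gram matrix `⟨b_i, b_j⟩ = δ_{ij}` (tree `peterssonProduct (Gamma0 N) κ`) which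
spans `S_κ(N)` over `ℂ` (Gram condition split into diagonal / off-diagonal parts to avoid a
decidability instance on the index type). [cite: BykovskiiFrolenkov2017, §1 (p. 5, «ортонормированный базис O_{2k}(N)»)] -/
structure IsOrthonormalBasis [NeZero N] {ι : Type*} [Fintype ι] (b : ι → CuspForm (Gamma0 N) κ) :
    Prop where
  gram_self : ∀ i, peterssonProduct (Gamma0 N) κ (b i) (b i) = 1
  gram_of_ne : ∀ i j, i ≠ j → peterssonProduct (Gamma0 N) κ (b i) (b j) = 0
  span_top : ⊤ ≤ Submodule.span ℂ (Set.range b)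

/-- **The normalising constant `Γ(κ−1)/(4π)^{κ−1}`** in front of the orthonormal-basis sum (for
weight `κ = 2k`: `Γ(2k−1)/(4π)^{2k−1}`); real power as in `IwaniecSarnak.harmonicWeight`.
[cite: BykovskiiFrolenkov2017, Theorem 1.1] -/
def gammaFactor (κ : ℤ) : ℝ :=
  Real.Gamma ((κ : ℝ) - 1) / (4 * Real.pi) ^ ((κ : ℝ) - 1)

/-- **The left-hand side `(Γ(κ−1)/(4π)^{κ−1}) Σ_{f ∈ O} |L_f(½ + it)|²`** for a finite family
`b` (an orthonormal basis in the theorems), `L_f = IwaniecSarnak.analyticL f`.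
[cite: BykovskiiFrolenkov2017, Theorem 1.1 (left-hand side)] -/
def secondMoment {ι : Type*} [Fintype ι] (b : ι → CuspForm (Gamma0 N) κ) (t : ℝ) : ℝ :=
  gammaFactor κ * ∑ i, ‖analyticL (b i) (1 / 2 + (t : ℂ) * I)‖ ^ 2

/-- **`W_{2k}(N;t) = log N + 2γ − 2 log(2π) + Γ′/Γ(k+it) + Γ′/Γ(k−it)`** ((1.1); a real number,
typed in `ℂ`; `Γ′/Γ` = Mathlib's `Complex.digamma = logDeriv Γ`, which is the sibling file's
`BalkanovaFrolenkov2017.digamma` — proved below). [cite: BykovskiiFrolenkov2017, §1 (1.1)] -/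
def mainTermW (k N : ℕ) (t : ℝ) : ℂ :=
  ((Real.log N + 2 * Real.eulerMascheroniConstant - 2 * Real.log (2 * Real.pi) : ℝ) : ℂ) +
    Complex.digamma ((k : ℂ) + (t : ℂ) * I) + Complex.digamma ((k : ℂ) - (t : ℂ) * I)

/-- **`U_{2k}(t) = ζ(1+2it)(2π)^{−2it}·Γ(k+it)/Γ(k−it) + ζ(1−2it)(2π)^{2it}·Γ(k−it)/Γ(k+it)`**
(a real number, typed in `ℂ`; at `t = 0` the printed expression has a removable singularity and
this Lean term is a junk value — see the module docstring). [cite: BykovskiiFrolenkov2017, §1 (display after (1.1))] -/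
def mainTermU (k : ℕ) (t : ℝ) : ℂ :=
  riemannZeta (1 + 2 * (t : ℂ) * I) / ((2 * Real.pi : ℝ) : ℂ) ^ (2 * (t : ℂ) * I) *
      (Complex.Gamma ((k : ℂ) + (t : ℂ) * I) / Complex.Gamma ((k : ℂ) - (t : ℂ) * I)) +
    riemannZeta (1 - 2 * (t : ℂ) * I) / ((2 * Real.pi : ℝ) : ℂ) ^ (-(2 * (t : ℂ) * I)) *
      (Complex.Gamma ((k : ℂ) - (t : ℂ) * I) / Complex.Gamma ((k : ℂ) + (t : ℂ) * I))

/-- **The main term `W_{2k}(N;t) + (−1)^k δ_{1,N} U_{2k}(t)`** of Theorems 1.1/1.2 (`δ_{1,N}` the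
Kronecker symbol). [cite: BykovskiiFrolenkov2017, Theorem 1.1] -/
def mainTerm (k N : ℕ) (t : ℝ) : ℂ :=
  mainTermW k N t + if N = 1 then (-1 : ℂ) ^ k * mainTermU k t else 0

/-- The printed error size of Theorem 1.1: `((1+|t|)/(kN)) · (kN(1+|t|))^ε`.
[cite: BykovskiiFrolenkov2017, Theorem 1.1] -/
def errorV1 (ε : ℝ) (k N : ℕ) (t : ℝ) : ℝ :=
  (1 + |t|) / ((k : ℝ) * N) * ((k : ℝ) * N * (1 + |t|)) ^ ε

/-- The printed error size of Theorem 1.2: `(T/(kN)) · (kNT)^ε`.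
[cite: BykovskiiFrolenkov2017, Theorem 1.2] -/
def errorV2 (ε : ℝ) (k N : ℕ) (T : ℝ) : ℝ :=
  T / ((k : ℝ) * N) * ((k : ℝ) * N * T) ^ ε

end BykovskiiFrolenkov2017

open BykovskiiFrolenkov2017

/-! ### The named facts -/

/-- **Bykovskii–Frolenkov 2017, Theorem 1.1** (NAMED FACT, AS PRINTED; theorem in print, not proved
here). For all natural `k ≥ 1`, `N ≥ 1` and real `t`, and every orthonormal basis `O_{2k}(N)` of
`S_{2k}(Γ₀(N))` for the Petersson product:
`(Γ(2k−1)/(4π)^{2k−1}) Σ_{f ∈ O_{2k}(N)} |L_f(½+it)|² = W_{2k}(N;t) + (−1)^k δ_{1,N} U_{2k}(t) + V₁(k,N;t)`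
with `V₁(k,N;t) ≪_ε ((1+|t|)/(kN))·(kN(1+|t|))^ε` for every `ε > 0` (implied constant depending on
`ε` only). Lean: `∀ ε > 0 ∃ C > 0 ∀ k ≥ 1 ∀ N ≥ 1 ∀ t ∀ (b : Fin n → S_{2k}(N))` orthonormal basis,
`|secondMoment b t − mainTerm k N t| ≤ C · errorV1 ε k N t`; the single point `(N,t) = (1,0)`, where
the printed `U_{2k}` is a removable singularity and Mathlib's `ζ(1)` is junk, is EXCLUDED (weaker
than print there only). [cite: BykovskiiFrolenkov2017, Theorem 1.1 (p. 5–6)] -/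
def bykovskiiFrolenkov2017_theorem11 : Prop :=
  ∀ ε : ℝ, 0 < ε → ∃ C : ℝ, 0 < C ∧
    ∀ (k N : ℕ) [NeZero N] (t : ℝ), 1 ≤ k → (N = 1 → t ≠ 0) →
      ∀ (n : ℕ) (b : Fin n → CuspForm (Gamma0 N) (2 * (k : ℤ))), IsOrthonormalBasis b →
        ‖((secondMoment b t : ℝ) : ℂ) - mainTerm k N t‖ ≤ C * errorV1 ε k N t

/-- **Bykovskii–Frolenkov 2017, Theorem 1.2** (NAMED FACT, AS PRINTED; theorem in print, not proved
here). For all natural `k ≥ 1`, `N ≥ 1` and real `T > 1`, and every orthonormal basis `O_{2k}(N)`: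
`(Γ(2k−1)/(4π)^{2k−1}) Σ_{f ∈ O_{2k}(N)} ∫₀^T |L_f(½+it)|² dt = ∫₀^T (W_{2k}(N;t) + (−1)^k δ_{1,N} U_{2k}(t)) dt + V₂(k,N;T)`
with `V₂(k,N;T) ≪_ε (T/(kN))·(kNT)^ε` for every `ε > 0` (constant depending on `ε` only).
[cite: BykovskiiFrolenkov2017, Theorem 1.2 (p. 6)] -/
def bykovskiiFrolenkov2017_theorem12 : Prop :=
  ∀ ε : ℝ, 0 < ε → ∃ C : ℝ, 0 < C ∧
    ∀ (k N : ℕ) [NeZero N] (T : ℝ), 1 ≤ k → 1 < T →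
      ∀ (n : ℕ) (b : Fin n → CuspForm (Gamma0 N) (2 * (k : ℤ))), IsOrthonormalBasis b →
        ‖((gammaFactor (2 * (k : ℤ)) *
              ∑ i, ∫ t in (0 : ℝ)..T, ‖analyticL (b i) (1 / 2 + (t : ℂ) * I)‖ ^ 2 : ℝ) : ℂ) -
            ∫ t in (0 : ℝ)..T, mainTerm k N t‖ ≤ C * errorV2 ε k N T

/-! ### Bookkeeping (proved) -/

namespace BykovskiiFrolenkov2017

variable {N : ℕ} {κ : ℤ}

/-- `Γ′/Γ` of the sibling file (`deriv Γ / Γ`, Balkanova–Frolenkov 2018) is Mathlib's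
`Complex.digamma = logDeriv Γ`; so `W_{2k}(N;t)` here and the `Γ′/Γ` terms of
`BalkanovaFrolenkov2017.M2MainTerm` are the same function. [cite: BykovskiiFrolenkov2017, §1 (1.1)] -/
theorem digamma_eq_balkanovaFrolenkov (z : ℂ) :
    Complex.digamma z = BalkanovaFrolenkov2017.digamma z := by
  rw [Complex.digamma_def, logDeriv_apply]
  rfl

/-- The left-hand side is invariant under reindexing the basis.
[cite: BykovskiiFrolenkov2017, Theorem 1.1 (left-hand side)] -/
theorem secondMoment_reindex {ι ι' : Type*} [Fintype ι] [Fintype ι']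
    (b : ι → CuspForm (Gamma0 N) κ) (e : ι' ≃ ι) (t : ℝ) :
    secondMoment (b ∘ e) t = secondMoment b t := by
  unfold secondMoment
  congr 1
  exact Fintype.sum_equiv e _ _ fun _ => rfl

variable [NeZero N]

/-- An orthonormal basis stays one after reindexing along an equivalence of index types.
[cite: BykovskiiFrolenkov2017, §1 (orthonormal basis)] -/
theorem IsOrthonormalBasis.reindex {ι ι' : Type*} [Fintype ι] [Fintype ι']
    {b : ι → CuspForm (Gamma0 N) κ} (hb : IsOrthonormalBasis b) (e : ι' ≃ ι) :
    IsOrthonormalBasis (b ∘ e) := by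
  refine ⟨fun i => hb.gram_self (e i), fun i j hij => hb.gram_of_ne _ _ fun h => hij (e.injective h),
    ?_⟩
  rw [Set.range_comp, e.surjective.range_eq, Set.image_univ]
  exact hb.span_top

/-- On a Petersson-orthonormal family the diagonal Gram entries are `1`; in particular
`re ⟨b_i, b_i⟩ = 1`. [cite: BykovskiiFrolenkov2017, §1 (orthonormal basis)] -/
theorem IsOrthonormalBasis.re_self {ι : Type*} [Fintype ι] {b : ι → CuspForm (Gamma0 N) κ}
    (hb : IsOrthonormalBasis b) (i : ι) :
    (peterssonProduct (Gamma0 N) κ (b i) (b i)).re = 1 := by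
  rw [hb.gram_self, Complex.one_re]

/-- **The printed constant is the harmonic weight.** On a Petersson-orthonormal basis the tree's
harmonic weight `ω_f = Γ(κ−1)/((4π)^{κ−1}⟨f,f⟩)` of every basis element equals the constant
`Γ(κ−1)/(4π)^{κ−1}` in front of the sum in Theorem 1.1.
[cite: BykovskiiFrolenkov2017, Theorem 1.1] [cite: IwaniecKowalski2004, Prop. 14.5 (14.15)] -/
theorem harmonicWeight_eq_gammaFactor {ι : Type*} [Fintype ι] {b : ι → CuspForm (Gamma0 N) κ}
    (hb : IsOrthonormalBasis b) (i : ι) :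
    harmonicWeight (b i) = gammaFactor κ := by
  unfold harmonicWeight gammaFactor
  rw [hb.re_self, mul_one]

/-- **Harmonic-sum form of the left-hand side**: on an orthonormal basis,
`(Γ(κ−1)/(4π)^{κ−1}) Σ_f |L_f(½+it)|² = Σ_f ω_f |L_f(½+it)|²` with the tree's harmonic weights
`ω_f = IwaniecSarnak.harmonicWeight f`. [cite: BykovskiiFrolenkov2017, Theorem 1.1] -/
theorem secondMoment_eq_harmonic {ι : Type*} [Fintype ι] {b : ι → CuspForm (Gamma0 N) κ}
    (hb : IsOrthonormalBasis b) (t : ℝ) :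
    secondMoment b t = ∑ i, harmonicWeight (b i) * ‖analyticL (b i) (1 / 2 + (t : ℂ) * I)‖ ^ 2 := by
  unfold secondMoment
  rw [Finset.mul_sum]
  exact Finset.sum_congr rfl fun i _ => by rw [harmonicWeight_eq_gammaFactor hb]

/-- **The consumer's currency.** On an orthonormal basis the left-hand side of Theorem 1.1 is the
unmollified second moment `A₂ = Σ_i ω_i · M_i² · L_i²` of the weighted family
`(ω_i, L_i, M_i) = (ω_{b_i}, |L_{b_i}(½+it)|, 1)` — the quantity on the right of
`CentralValueFamilyPigeonhole.weight_floor_ge_of_mollified` at `M ≡ 1`.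
[cite: BykovskiiFrolenkov2017, Theorem 1.1] [cite: BalkanovaFrolenkov2021, §8.4 (proof of Theorem 8.7)] -/
theorem secondMoment_eq_familySum {ι : Type*} [Fintype ι] {b : ι → CuspForm (Gamma0 N) κ}
    (hb : IsOrthonormalBasis b) (t : ℝ) :
    secondMoment b t =
      ∑ i ∈ Finset.univ, harmonicWeight (b i) * (1 : ℝ) ^ 2 *
        ‖analyticL (b i) (1 / 2 + (t : ℂ) * I)‖ ^ 2 := by
  rw [secondMoment_eq_harmonic hb]
  exact Finset.sum_congr rfl fun i _ => by ring

/-- The printed error sizes are nonnegative (for `k, N ≥ 0`, any `t`; `T ≥ 0`).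
[cite: BykovskiiFrolenkov2017, Theorem 1.1] -/
theorem errorV1_nonneg (ε : ℝ) (k N : ℕ) (t : ℝ) : 0 ≤ errorV1 ε k N t := by
  unfold errorV1
  have h1 : 0 ≤ 1 + |t| := by positivity
  positivity

/-- [cite: BykovskiiFrolenkov2017, Theorem 1.2] -/
theorem errorV2_nonneg (ε : ℝ) (k N : ℕ) {T : ℝ} (hT : 0 ≤ T) : 0 ≤ errorV2 ε k N T := by
  unfold errorV2
  positivity

end BykovskiiFrolenkov2017

/-! ### Consequences of the facts (proved: hypotheses `h : <fact>` are explicit) -/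

/-- **Theorem 1.1 for an arbitrary finite index type** (from the `Fin n`-indexed statement, by
reindexing along `Fintype.equivFin`). [cite: BykovskiiFrolenkov2017, Theorem 1.1] -/
theorem bykovskiiFrolenkov2017_theorem11.of_fintype (h : bykovskiiFrolenkov2017_theorem11)
    {ε : ℝ} (hε : 0 < ε) :
    ∃ C : ℝ, 0 < C ∧ ∀ (k N : ℕ) [NeZero N] (t : ℝ), 1 ≤ k → (N = 1 → t ≠ 0) →
      ∀ {ι : Type} [Fintype ι] (b : ι → CuspForm (Gamma0 N) (2 * (k : ℤ))),
        IsOrthonormalBasis b →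
          ‖((secondMoment b t : ℝ) : ℂ) - mainTerm k N t‖ ≤ C * errorV1 ε k N t := by
  obtain ⟨C, hC, hmain⟩ := h ε hε
  refine ⟨C, hC, fun k N _ t hk hNt ι _ b hb => ?_⟩
  have key := hmain k N t hk hNt (Fintype.card ι) (b ∘ (Fintype.equivFin ι).symm)
    (hb.reindex (Fintype.equivFin ι).symm)
  rwa [secondMoment_reindex] at key

/-- **Two-sided bound for the unmollified harmonic second moment in the family currency** (from
Theorem 1.1): for every `ε > 0` there is `C > 0` such that for all `k ≥ 1`, `N ≥ 2`, `t ∈ ℝ` and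
every Petersson-orthonormal basis `b` of `S_{2k}(N)`,
`|Σ_i ω_{b_i}·1²·|L_{b_i}(½+it)|² − Re W_{2k}(N;t)| ≤ C·((1+|t|)/(kN))·(kN(1+|t|))^ε`
(`δ_{1,N} = 0`; the real part of a complex number is within its norm). This is the shape in which
`CentralValueFamilyPigeonhole.weight_floor_ge_of_mollified` consumes the second moment `A₂` at
`M ≡ 1`. [cite: BykovskiiFrolenkov2017, Theorem 1.1] -/
theorem bykovskiiFrolenkov2017_theorem11.familySum_sub_re_le (h : bykovskiiFrolenkov2017_theorem11)
    {ε : ℝ} (hε : 0 < ε) :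
    ∃ C : ℝ, 0 < C ∧ ∀ (k N : ℕ) [NeZero N] (t : ℝ), 1 ≤ k → 2 ≤ N →
      ∀ {ι : Type} [Fintype ι] (b : ι → CuspForm (Gamma0 N) (2 * (k : ℤ))),
        IsOrthonormalBasis b →
          |∑ i ∈ Finset.univ, harmonicWeight (b i) * (1 : ℝ) ^ 2 *
                ‖analyticL (b i) (1 / 2 + (t : ℂ) * I)‖ ^ 2 -
              (mainTermW k N t).re| ≤ C * errorV1 ε k N t := by
  obtain ⟨C, hC, hmain⟩ := h.of_fintype hε
  refine ⟨C, hC, fun k N _ t hk hN ι _ b hb => ?_⟩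
  have hN1 : N ≠ 1 := by omega
  have key := hmain k N t hk (fun h1 => absurd h1 hN1) b hb
  rw [← secondMoment_eq_familySum hb]
  have hmt : mainTerm k N t = mainTermW k N t := by
    unfold mainTerm
    rw [if_neg hN1, add_zero]
  rw [hmt] at key
  calc |secondMoment b t - (mainTermW k N t).re|
      = |((((secondMoment b t : ℝ) : ℂ) - mainTermW k N t).re)| := by
        rw [Complex.sub_re, Complex.ofReal_re]
    _ ≤ ‖((secondMoment b t : ℝ) : ℂ) - mainTermW k N t‖ := Complex.abs_re_le_norm _
    _ ≤ C * errorV1 ε k N t := key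

/-! ### From orthonormal to orthogonal bases: the statement in harmonic weights (proved)

An orthogonal basis of nonzero forms `(b_i)` (e.g. a Hecke eigenbasis when there are no old forms)
becomes orthonormal after the scaling `b_i ↦ ⟨b_i,b_i⟩^{−1/2} b_i`; since `L_{c f} = c L_f` and
`⟨c f, c f⟩ = |c|² ⟨f,f⟩`, Theorem 1.1 for the scaled basis reads
`Σ_i ω_{b_i} |L_{b_i}(½+it)|² = W + (−1)^k δ_{1,N} U + V₁` with the tree's harmonic weights
`ω_f = Γ(2k−1)/((4π)^{2k−1}⟨f,f⟩)` — the currency of `IwaniecSarnak.harmonicSum`. -/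

namespace BykovskiiFrolenkov2017

variable {N : ℕ} {κ : ℤ}

/-- `a_n(c • f) = c · a_n(f)` (the Fourier coefficients at the width-one cusp `∞` of `Γ₀(N)` are
linear; Mathlib `ModularForm.qExpansion_smul`; private plumbing for `analyticL_smul`). [folklore] -/
private theorem cuspCoeff_smul (c : ℂ) (f : CuspForm (Gamma0 N) κ) (n : ℕ) :
    cuspCoeff (c • f) n = c * cuspCoeff f n := by
  have hΓ : (1 : ℝ) ∈ (Gamma0 N : Subgroup (GL (Fin 2) ℝ)).strictPeriods := by
    rw [strictPeriods_Gamma0]; exact AddSubgroup.mem_zmultiples 1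
  change (UpperHalfPlane.qExpansion 1 ⇑(c • f)).coeff n =
    c * (UpperHalfPlane.qExpansion 1 ⇑f).coeff n
  rw [CuspForm.IsGLPos.coe_smul, ModularForm.qExpansion_smul one_pos hΓ, map_smul, smul_eq_mul]

/-- The entire continuation scales: `entireLSeries (c • a) σ₀ s = c · entireLSeries a σ₀ s` (if
`Σ a(n)n^{−s}` has an entire continuation `g`, then `c g` continues `Σ c a(n) n^{−s}`; otherwise both
sides are the junk `L`-series values, which scale too). [cite: DiamondShurman2005, Thm. 5.10.2] -/
theorem entireLSeries_const_smul (c : ℂ) (a : ℕ → ℂ) (σ₀ : ℝ) (s : ℂ) :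
    entireLSeries (c • a) σ₀ s = c * entireLSeries a σ₀ s := by
  classical
  by_cases h : (LSeriesContinuations a σ₀).Nonempty
  · obtain ⟨g, hg⟩ := h
    have hcg : (fun z => c * g z) ∈ LSeriesContinuations (c • a) σ₀ :=
      ⟨(differentiable_const c).mul hg.1, fun z hz => by dsimp only; rw [hg.2 z hz, LSeries_smul]⟩
    rw [entireLSeries_eq_of_mem hcg, entireLSeries_eq_of_mem hg]
  · by_cases hc : c = 0
    · subst hc
      have h0 : (fun _ : ℂ => (0 : ℂ)) ∈ LSeriesContinuations ((0 : ℂ) • a) σ₀ :=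
        ⟨differentiable_const 0, fun z _ => by dsimp only; rw [LSeries_smul, zero_mul]⟩
      rw [entireLSeries_eq_of_mem h0, zero_mul]
    · have h' : ¬ (LSeriesContinuations (c • a) σ₀).Nonempty := by
        rintro ⟨g, hg⟩
        refine h ⟨fun z => c⁻¹ * g z, (differentiable_const _).mul hg.1, fun z hz => ?_⟩
        dsimp only
        rw [hg.2 z hz, LSeries_smul, ← mul_assoc, inv_mul_cancel₀ hc, one_mul]
      unfold entireLSeries
      rw [dif_neg h', dif_neg h, LSeries_smul]

/-- **`L_{c f}(s) = c · L_f(s)`** for the analytically normalised `L`-series of a cusp form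
(linearity of `f ↦ L_f(s)`, the mechanism behind "the elements of `O_{2k}(N)` and `H*_{2k}(N)`
differ only by normalisation", p0003:L82–L87). [cite: BykovskiiFrolenkov2017, §1 (p. 6)] -/
theorem analyticL_smul (c : ℂ) (f : CuspForm (Gamma0 N) κ) (s : ℂ) :
    analyticL (c • f) s = c * analyticL f s := by
  unfold analyticL
  have : cuspCoeff (c • f) = c • cuspCoeff f := funext fun n => by
    rw [Pi.smul_apply, smul_eq_mul, cuspCoeff_smul]
  rw [this, entireLSeries_const_smul]

variable [NeZero N]

/-- **An orthogonal basis of nonzero forms** of `S_κ(Γ₀(N))` for the Petersson product (e.g. a basis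
of Hecke newforms when `S_κ(N)` has no old forms, p0003:L82–L87): pairwise orthogonal, nonzero,
spanning. [cite: BykovskiiFrolenkov2017, §1 (p. 6, «ортогональный базис H*_{2k}(N)»)] -/
structure IsOrthogonalBasis {ι : Type*} [Fintype ι] (b : ι → CuspForm (Gamma0 N) κ) : Prop where
  ne_zero : ∀ i, b i ≠ 0
  gram_of_ne : ∀ i j, i ≠ j → peterssonProduct (Gamma0 N) κ (b i) (b j) = 0
  span_top : ⊤ ≤ Submodule.span ℂ (Set.range b)

/-- The Petersson norm `⟨f,f⟩^{1/2}` (real part; `⟨f,f⟩` is real and `> 0` for `f ≠ 0` by the tree's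
PROVED `peterssonProduct_conj_symm_holds`, `peterssonProduct_self_pos_holds`).
[cite: DiamondShurman2005, §5.4 (after Def. 5.4.1), p. 183] -/
def peterssonNorm (f : CuspForm (Gamma0 N) κ) : ℝ :=
  Real.sqrt (peterssonProduct (Gamma0 N) κ f f).re

/-- The normalised family `b_i / ⟨b_i,b_i⟩^{1/2}`. [cite: BykovskiiFrolenkov2017, §1 (p. 6)] -/
def normalizeBasis {ι : Type*} (b : ι → CuspForm (Gamma0 N) κ) (i : ι) : CuspForm (Gamma0 N) κ :=
  ((peterssonNorm (b i))⁻¹ : ℂ) • b i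

/-- `⟨f,f⟩` is real: `⟨f,f⟩ = re⟨f,f⟩` (the Petersson product is Hermitian-symmetric — tree theorem
`peterssonProduct_conj_symm_holds`). [cite: DiamondShurman2005, §5.4 (after Def. 5.4.1), p. 183] -/
theorem peterssonProduct_self_eq_re (f : CuspForm (Gamma0 N) κ) :
    peterssonProduct (Gamma0 N) κ f f = ((peterssonProduct (Gamma0 N) κ f f).re : ℂ) :=
  (Complex.conj_eq_iff_re.mp (peterssonProduct_conj_symm_holds (Gamma0 N) κ f f).symm).symm

/-- `⟨f,f⟩^{1/2} > 0` for `f ≠ 0` (the Petersson product is positive definite — tree theorem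
`peterssonProduct_self_pos_holds`). [cite: DiamondShurman2005, §5.4 (after Def. 5.4.1), p. 183] -/
theorem peterssonNorm_pos {f : CuspForm (Gamma0 N) κ} (hf : f ≠ 0) : 0 < peterssonNorm f :=
  Real.sqrt_pos.mpr (peterssonProduct_self_pos_holds (Gamma0 N) κ hf)

/-- `(⟨f,f⟩^{1/2})² = re⟨f,f⟩` (`re⟨f,f⟩ ≥ 0`, positive (semi)definiteness).
[cite: DiamondShurman2005, §5.4 (after Def. 5.4.1), p. 183] -/
theorem peterssonNorm_sq (f : CuspForm (Gamma0 N) κ) :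
    peterssonNorm f ^ 2 = (peterssonProduct (Gamma0 N) κ f f).re :=
  Real.sq_sqrt (re_peterssonProduct_self_nonneg_level (Gamma0 N) κ f)

/-- **Normalising an orthogonal basis gives an orthonormal basis.**
[cite: BykovskiiFrolenkov2017, §1 (p. 6, «отличаются только нормировкой»)] -/
theorem IsOrthogonalBasis.isOrthonormalBasis_normalizeBasis {ι : Type*} [Fintype ι]
    {b : ι → CuspForm (Gamma0 N) κ} (hb : IsOrthogonalBasis b) :
    IsOrthonormalBasis (normalizeBasis b) := by
  refine ⟨fun i => ?_, fun i j hij => ?_, ?_⟩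
  · have hr : 0 < peterssonNorm (b i) := peterssonNorm_pos (hb.ne_zero i)
    unfold normalizeBasis
    rw [peterssonProduct_smul_smul, peterssonProduct_self_eq_re, ← peterssonNorm_sq,
      ← Complex.ofReal_inv, Complex.conj_ofReal]
    push_cast
    field_simp
    exact div_self (Complex.ofReal_ne_zero.mpr hr.ne')
  · unfold normalizeBasis
    rw [peterssonProduct_smul_left, peterssonProduct_smul_right, hb.gram_of_ne i j hij, mul_zero,
      mul_zero]
  · refine le_trans hb.span_top (Submodule.span_le.mpr ?_)
    rintro _ ⟨i, rfl⟩
    have hr : (peterssonNorm (b i) : ℂ) ≠ 0 :=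
      Complex.ofReal_ne_zero.mpr (peterssonNorm_pos (hb.ne_zero i)).ne'
    have hmem : normalizeBasis b i ∈ Submodule.span ℂ (Set.range (normalizeBasis b)) :=
      Submodule.subset_span ⟨i, rfl⟩
    have : b i = (peterssonNorm (b i) : ℂ) • normalizeBasis b i := by
      unfold normalizeBasis
      rw [smul_smul, mul_inv_cancel₀ hr, one_smul]
    rw [this]
    exact Submodule.smul_mem _ _ hmem

/-- **The normalised second moment is the harmonic sum over the orthogonal basis**:
`(Γ(κ−1)/(4π)^{κ−1}) Σ_i |L_{e_i}(½+it)|² = Σ_i ω_{b_i} |L_{b_i}(½+it)|²`, `e_i = b_i/⟨b_i,b_i⟩^{1/2}`,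
`ω_f = Γ(κ−1)/((4π)^{κ−1}⟨f,f⟩) = IwaniecSarnak.harmonicWeight f`.
[cite: BykovskiiFrolenkov2017, Theorem 1.1] [cite: IwaniecKowalski2004, Prop. 14.5 (14.15)] -/
theorem secondMoment_normalizeBasis {ι : Type*} [Fintype ι] {b : ι → CuspForm (Gamma0 N) κ}
    (hb : IsOrthogonalBasis b) (t : ℝ) :
    secondMoment (normalizeBasis b) t =
      ∑ i, harmonicWeight (b i) * ‖analyticL (b i) (1 / 2 + (t : ℂ) * I)‖ ^ 2 := by
  unfold secondMoment
  rw [Finset.mul_sum]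
  refine Finset.sum_congr rfl fun i _ => ?_
  have hr : 0 < peterssonNorm (b i) := peterssonNorm_pos (hb.ne_zero i)
  have hL : ‖analyticL (normalizeBasis b i) (1 / 2 + (t : ℂ) * I)‖ =
      (peterssonNorm (b i))⁻¹ * ‖analyticL (b i) (1 / 2 + (t : ℂ) * I)‖ := by
    unfold normalizeBasis
    rw [analyticL_smul, norm_mul, ← Complex.ofReal_inv, Complex.norm_real,
      Real.norm_of_nonneg (inv_nonneg.mpr hr.le)]
  have hw : harmonicWeight (b i) = gammaFactor κ * (peterssonNorm (b i))⁻¹ ^ 2 := by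
    unfold harmonicWeight gammaFactor
    rw [← peterssonNorm_sq, inv_pow, div_mul_eq_div_div, div_eq_mul_inv]
  rw [hL, hw]
  ring

end BykovskiiFrolenkov2017

/-- **Theorem 1.1 in harmonic weights over any orthogonal basis** (from the named fact, by
normalisation): for every `ε > 0` there is `C > 0` such that for all `k ≥ 1`, `N ≥ 1`, `t ∈ ℝ`
(`t ≠ 0` if `N = 1`) and every Petersson-ORTHOGONAL basis `(b_i)` of nonzero forms of
`S_{2k}(Γ₀(N))`,
`|Σ_i ω_{b_i} |L_{b_i}(½+it)|² − W_{2k}(N;t) − (−1)^k δ_{1,N} U_{2k}(t)| ≤ C·((1+|t|)/(kN))·(kN(1+|t|))^ε`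
with the tree's harmonic weights `ω_f = IwaniecSarnak.harmonicWeight f`. For prime `N` and
`2k ∈ {2,4,6,8,10,14}` (no old forms) a Hecke eigenbasis is such a basis (p0003:L82–L87).
[cite: BykovskiiFrolenkov2017, Theorem 1.1 (p. 5–6)] -/
theorem bykovskiiFrolenkov2017_theorem11.harmonic (h : bykovskiiFrolenkov2017_theorem11)
    {ε : ℝ} (hε : 0 < ε) :
    ∃ C : ℝ, 0 < C ∧ ∀ (k N : ℕ) [NeZero N] (t : ℝ), 1 ≤ k → (N = 1 → t ≠ 0) →
      ∀ {ι : Type} [Fintype ι] (b : ι → CuspForm (Gamma0 N) (2 * (k : ℤ))),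
        IsOrthogonalBasis b →
          ‖((∑ i, harmonicWeight (b i) * ‖analyticL (b i) (1 / 2 + (t : ℂ) * I)‖ ^ 2 : ℝ) : ℂ) -
              mainTerm k N t‖ ≤ C * errorV1 ε k N t := by
  obtain ⟨C, hC, hmain⟩ := h.of_fintype hε
  refine ⟨C, hC, fun k N _ t hk hNt ι _ b hb => ?_⟩
  have key := hmain k N t hk hNt (normalizeBasis b) hb.isOrthonormalBasis_normalizeBasis
  rwa [secondMoment_normalizeBasis hb] at key

end Literature.NumberTheory.LFunctions

end
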